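import Literature.Probability.Percolation.TrapTermFenceUp
import Literature.Probability.Percolation.TrapFenceBelowTall
import HarnessLib

/-!
# Term fences from above with a tall exterior vertical crossing

Topic `Literature/Probability/Percolation`; family `crit-perc` / near-critical percolation on `𝕋`.
A brick of the near-critical arm-separation theorem for four arms in the ADJACENT colour
arrangement (P. Nolin, EJP 13 (2008), Thm. 11, `j = 4`, `σ = BBWW` [arXiv 0711.4948: Thm. 10]).

`TermFenceUpT` — a `TermFenceUp` (fence of a term explored from above) carrying, through the same
end point `m`, an open vertical crossing of the tall box `[z₀ + k, z₀ + 2k] × [z₁ - 2k, z₁ - 1]`;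
`TrapRawOKUp.nonempty_termFenceUpT` — existence on the raw good event
(`trap_exists_fence_below_tall₂`). Everything here is proved.

## References

* P. Nolin, Near-critical percolation in two dimensions, *Electron. J. Probab.* 13 (2008), §4.4,
  proof of Lemma 15 (arXiv 0711.4948: Lemma 14) [Nolin2008].
-/

noncomputable section

open Set

namespace Literature.Probability.Percolation

open LatticeModels

/-- **A term fence from above with a tall vertical crossing through its end point.** [cite: Nolin2008, §4.4 Lemma 15 (proof) (arXiv 0711.4948: Lemma 14)] -/
structure TermFenceUpT (M : ℕ) (d : Finset (Site 2)) (z : Site 2) (k : ℕ) (ω : SiteConfig (Site 2)) (S : Set (Site 2))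
    extends TermFenceUp M d z k ω S where
  vtall : OpenVCrossThrough (triStrip (z 0 + k) (z 1 - 2 * k) k (2 * k - 1)) (z 1 - 2 * k) (z 1 - 1) ω m

namespace TrapRawOKUp

variable {M k : ℕ} {d : Finset (Site 2)} {z : Site 2} {ω : SiteConfig (Site 2)}

/-- **Fences from above with both crossings exist on the raw good event** (`trap_exists_fence_below_tall₂`). [cite: Nolin2008, §4.4 Lemma 15 (proof) (arXiv 0711.4948: Lemma 14)] -/
theorem exists_fence_below_tall₂ (h : TrapRawOKUp M d z k ω) (hk : 1 ≤ k) (hkM : 2 * (k : ℤ) + 1 ≤ M)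
    (hd : (trapDomain M).flip.IsCrossing d z) (hz0 : z 1 < 0) (hzB : -(2 * (M : ℤ)) < z 1)
    {S : Set (Site 2)} (hdS : (↑d : Set (Site 2)) ⊆ S) (hSn : ∀ v ∈ S, triNorm v ≤ 2 * M) :
    ∃ m : Site 2, OpenVCrossThrough (triStrip (z 0 + k) (z 1 - 2 * k) k k) (z 1 - 2 * k) (z 1 - k) ω m ∧
      OpenVCrossThrough (triStrip (z 0 + k) (z 1 - 2 * k) k (2 * k - 1)) (z 1 - 2 * k) (z 1 - 1) ω m ∧
      ∃ q ∈ S, ∃ p : Site 2, triGraph.Adj q p ∧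
        PathIn triGraph ((trapFrameZoneBelow M z k ∩
          {v | (triNorm v ≤ 2 * M → v ∈ (trapDomain M).flip.above d z) ∧ (2 * (M : ℤ) < triNorm v → v 1 < z 1)}) ∩
            ω ∩ Sᶜ) p m := by
  obtain ⟨ω', hagree, hω'⟩ := h
  exact trap_exists_fence_below_tall₂ hk hkM hd hz0 hzB hagree hω'.1.1.1 hdS hSn

/-- **Term fences from above with a tall crossing exist when the term did not fail (raw form).** [cite: Nolin2008, §4.4 Lemma 15 (proof) (arXiv 0711.4948: Lemma 14)] -/
theorem nonempty_termFenceUpT (h : TrapRawOKUp M d z k ω) (hk : 1 ≤ k) (hkM : 2 * (k : ℤ) + 1 ≤ M)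
    (hd : (trapDomain M).flip.IsCrossing d z) (hz0 : z 1 < 0) (hzB : -(2 * (M : ℤ)) < z 1)
    {S : Set (Site 2)} (hdS : (↑d : Set (Site 2)) ⊆ S) (hSn : ∀ v ∈ S, triNorm v ≤ 2 * M) :
    Nonempty (TermFenceUpT M d z k ω S) := by
  obtain ⟨m, hV, hVt, q, hqS, p, hqp, hpath⟩ := h.exists_fence_below_tall₂ hk hkM hd hz0 hzB hdS hSn
  obtain ⟨F, hF, hp, ht⟩ := hpath.exists_support
  exact ⟨{ m := m, q := q, p := p, F := F, vcross := hV, q_mem := hqS, adj := hqp, F_subset := hF,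
           path := hp, tight := ht, vtall := hVt }⟩

end TrapRawOKUp

namespace TermFenceUpT

variable {M k : ℕ} {d : Finset (Site 2)} {z : Site 2} {ω : SiteConfig (Site 2)} {S : Set (Site 2)}
  (T : TermFenceUpT M d z k ω S)

/-- **The upper exterior branch** of a fence from above: an open path from `m` up to a site of the
row `z₁ - 1` inside the tall box `[z₀ + k, z₀ + 2k] × [z₁ - 2k, z₁ - 1]`. [folklore] -/
theorem exists_branch_up :
    ∃ t : Site 2, t 1 = z 1 - 1 ∧ PathIn triGraph (triStrip (z 0 + k) (z 1 - 2 * k) k (2 * k - 1) ∩ ω) T.m t := by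
  obtain ⟨b, t, -, ht, -, hmt⟩ := T.vtall
  exact ⟨t, ht, hmt⟩

/-- **The lower exterior branch**: an open path from `m` down to a site of the row `z₁ - 2k`. [folklore] -/
theorem exists_branch_down :
    ∃ b : Site 2, b 1 = z 1 - 2 * k ∧ PathIn triGraph (triStrip (z 0 + k) (z 1 - 2 * k) k (2 * k - 1) ∩ ω) T.m b := by
  obtain ⟨b, t, hb, -, hbm, -⟩ := T.vtall
  exact ⟨b, hb, hbm.symm⟩

end TermFenceUpT

end Literature.Probability.Percolation
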